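import Mathlib
import Summits.NavierStokesRegularity.NavierStokesRegularity.Theorems.ScenarioCensusPeriodicSlabTools
import Summits.NavierStokesRegularity.NavierStokesRegularity.Theorems.ScenarioCensusPeriodicSlabEnergy
import Literature.Analysis.FluidPDE.TaoEnstrophyLocalisationProofs
import HarnessLib

/-!
# Census row S7 (bounded steady flows in the periodic slab, case (d)): the energy identity per
# period (window bookkeeping)

Support file for the scenario census of `NavierStokesRegularity` (cell `pub/ns-census`, row S7 =
Bang–Gui–Wang–Xie 2025, Thm 1.4 (d); tree FACT
`Literature.Analysis.FluidPDE.BangGuiWangXie2025_periodicSlab_liouville`, second conjunct).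
Printed proof, arXiv:2205.13259 §5 Step 4: test the differentiated momentum equation with
`φ_R ∂₃u` on `Ω = ℝ² × 𝕋`, absorb the convection term by the Wirtinger inequality when
`‖u‖_∞ < 2π`, and bound the cut-off terms.

* `window_identity` — the localised energy identity of the linearised system
  (`linearised_energy_identity`, `…PeriodicSlabEnergy`) with the test function
  `Φ = φ(x) ω_L(x₂)²` (`φ` an axially periodic `C¹` cut-off vanishing off a cylinder, `ω_L` the
  smooth partition-of-unity window of `PeriodicWindowIntegral`) becomes an identity between
  integrals over ONE period slab `zSlab L 0`: the terms in which the derivative falls on the window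
  are integrals of periodic densities against `(ω²)'` and vanish
  (`integral_mul_deriv_periodicWindow_sq_eq_zero`), the others are `∫ Q ω² = ∫_{slab} Q`
  (`integral_mul_periodicWindow_sq`).
The dyadic energy estimate built on this identity (cut-off `cylCutoff r (2r)`, Wirtinger absorption
of the convection term) is the sequel file `…PeriodicSlabEstimate`.

No summit statement and no census row is proved in this file.

## References

* J. Bang, C. Gui, Y. Wang, C. Xie, J. Fluid Mech. 1005 (2025) A6 = arXiv:2205.13259, §5 Step 4.
  [BangGuiWangXie2025]
-/

-- the summit and its single problem share the name (D-0017 nested layout)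
set_option linter.dupNamespace false

noncomputable section

open MeasureTheory Set Function Filter InnerProductSpace
open scoped Topology ENNReal NNReal RealInnerProductSpace Laplacian

namespace Summit.NavierStokesRegularity.NavierStokesRegularity.Theorems.ScenarioCensus.PeriodicSlab

open Literature.Analysis Literature.Analysis.FluidPDE

/-! ### Support of the window and of its derivative -/

/-- `ω_L(z)² ≠ 0 ⇒ |z| ≤ 2L` (`L > 0`). -/
theorem abs_le_of_periodicWindow_sq_ne_zero {L : ℝ} (hL : 0 < L) (z : ℝ)
    (hz : periodicWindow L z ^ 2 ≠ 0) : |z| ≤ 2 * L := by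
  have hz' : periodicWindow L z ≠ 0 := fun h => hz (by rw [h]; ring)
  have hm := mem_Ioo_of_periodicWindow_ne_zero hL hz'
  rw [abs_le]; constructor <;> linarith [hm.1, hm.2]

/-- `(ω_L²)'(z) ≠ 0 ⇒ |z| ≤ 2L` (`L > 0`): off `[0, 2L]` the window vanishes identically near `z`. -/
theorem abs_le_of_deriv_periodicWindow_sq_ne_zero {L : ℝ} (hL : 0 < L) (z : ℝ)
    (hz : deriv (fun s => periodicWindow L s ^ 2) z ≠ 0) : |z| ≤ 2 * L := by
  by_contra h
  rw [not_le] at h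
  apply hz
  have hzero : (fun s => periodicWindow L s ^ 2) =ᶠ[𝓝 z] fun _ => (0 : ℝ) := by
    rcases lt_or_ge z 0 with hneg | hpos
    · filter_upwards [Iio_mem_nhds hneg] with s hs
      rw [periodicWindow_eq_zero_of_nonpos hL (le_of_lt hs)]; ring
    · have h2 : 2 * L < z := by
        rw [abs_of_nonneg hpos] at h; exact h
      filter_upwards [Ioi_mem_nhds h2] with s hs
      rw [periodicWindow_eq_zero_of_two_mul_le hL (le_of_lt hs)]; ring
  rw [hzero.deriv_eq, deriv_const]

/-! ### The energy identity per period -/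

/-- **Window bookkeeping.** For a continuous axially `L`-periodic density `Q` vanishing off a
cylinder (`L > 0`): `∫ Q ω_L² = ∫_{zSlab L 0} Q`, `∫ Q (ω_L²)' = 0`, and both whole-space
integrands are integrable. -/
theorem window_bookkeeping {L : ℝ} (hL : 0 < L) {Q : EuclideanSpace ℝ (Fin 3) → ℝ}
    (hQc : Continuous Q) (hQper : IsAxiallyPeriodic L Q) {ρ : ℝ}
    (hQ0 : ∀ x, ρ ≤ cylRadius x → Q x = 0) :
    (∫ x, Q x * periodicWindow L (x 2) ^ 2 = ∫ x in zSlab L 0, Q x) ∧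
      (∫ x, Q x * deriv (fun s => periodicWindow L s ^ 2) (x 2) = 0) ∧
      Integrable (fun x => Q x * periodicWindow L (x 2) ^ 2) ∧
      Integrable (fun x => Q x * deriv (fun s => periodicWindow L s ^ 2) (x 2)) := by
  have hQi : IntegrableOn Q (zSlab L 0) volume := integrableOn_zSlab_of_eq_zero_of_le_cylRadius hQc hQ0 L 0
  have hQm : AEStronglyMeasurable Q volume := hQc.aestronglyMeasurable
  refine ⟨integral_mul_periodicWindow_sq hL hQper hQm hQi,
    integral_mul_deriv_periodicWindow_sq_eq_zero hL hQper hQm hQi,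
    integrable_mul_periodicWindow_sq hL hQper hQm hQi, ?_⟩
  have hc : Continuous fun x : EuclideanSpace ℝ (Fin 3) =>
      Q x * deriv (fun s => periodicWindow L s ^ 2) (x 2) :=
    hQc.mul (((contDiff_periodicWindow_sq L (n := 1)).continuous_deriv le_rfl).comp
      (EuclideanSpace.proj (2 : Fin 3) : EuclideanSpace ℝ (Fin 3) →L[ℝ] ℝ).continuous)
  exact hc.integrable_of_hasCompactSupport
    (hasCompactSupport_mul_comp_apply_two hQ0 (abs_le_of_deriv_periodicWindow_sq_ne_zero hL))

/-- **The localised energy identity per period.** Let `U ∈ C¹`, `w ∈ C²`, `q ∈ C¹` be axially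
`L`-periodic (`L > 0`) with `div U = div w = 0` and `ν Δw = (w·∇)U + (U·∇)w + ∇q`, and let
`φ ≥ 0` be an axially periodic `C¹` cut-off vanishing off a cylinder. Then, with
`S = zSlab L 0` one period and `eᵢ` the standard basis,
`ν ∫_S φ |Dw|² = −ν Σᵢ ∫_S (∂ᵢφ)⟪∂ᵢw, w⟫ + ½ ∫_S (Dφ·U)‖w‖² + ∫_S (Dφ·w)⟪U, w⟫`
`+ ∫_S φ⟪U, Dw(w)⟫ + ∫_S q (Dφ·w)` — the identity displayed after (6-1) in Bang–Gui–Wang–Xie,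
§5 Step 4, "integrating over `Ω`" realised through the window `ω_L²`. -/
theorem window_identity {ν L : ℝ} (hL : 0 < L)
    {U w : EuclideanSpace ℝ (Fin 3) → EuclideanSpace ℝ (Fin 3)} {q φ : EuclideanSpace ℝ (Fin 3) → ℝ}
    (hU : ContDiff ℝ 1 U) (hw : ContDiff ℝ 2 w) (hq : ContDiff ℝ 1 q)
    (hdivU : VectorCalculus.IsDivFree U) (hdivw : VectorCalculus.IsDivFree w)
    (hpde : ∀ x, ν • (Δ w) x = convect w U x + convect U w x + gradient q x)
    (hUper : IsAxiallyPeriodic L U) (hwper : IsAxiallyPeriodic L w) (hqper : IsAxiallyPeriodic L q)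
    (hφ : ContDiff ℝ 1 φ) (hφper : IsAxiallyPeriodic L φ) (hφnn : ∀ x, 0 ≤ φ x) {ρ : ℝ}
    (hφ0 : ∀ x, ρ ≤ cylRadius x → φ x = 0) :
    ν * ∫ x in zSlab L 0, φ x * frobeniusNormSq (fderiv ℝ w x) =
      -(ν * ∑ i, ∫ x in zSlab L 0, fderiv ℝ φ x (EuclideanSpace.basisFun (Fin 3) ℝ i) *
          ⟪fderiv ℝ w x (EuclideanSpace.basisFun (Fin 3) ℝ i), w x⟫) +
        2⁻¹ * (∫ x in zSlab L 0, fderiv ℝ φ x (U x) * ‖w x‖ ^ 2) +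
        (∫ x in zSlab L 0, fderiv ℝ φ x (w x) * ⟪U x, w x⟫) +
        (∫ x in zSlab L 0, φ x * ⟪U x, fderiv ℝ w x (w x)⟫) +
        ∫ x in zSlab L 0, q x * fderiv ℝ φ x (w x) := by
  set b := EuclideanSpace.basisFun (Fin 3) ℝ with hb
  set ω2 : ℝ → ℝ := fun s => periodicWindow L s ^ 2 with hω2
  set Φ : EuclideanSpace ℝ (Fin 3) → ℝ := fun x => φ x * ω2 (x 2) with hΦ
  -- regularity and support
  have hw1 : ContDiff ℝ 1 w := hw.of_le one_le_two
  have hUc : Continuous U := hU.continuous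
  have hwc : Continuous w := hw1.continuous
  have hqc : Continuous q := hq.continuous
  have hφc : Continuous φ := hφ.continuous
  have hDwc : Continuous (fderiv ℝ w) := hw1.continuous_fderiv one_ne_zero
  have hDφc : Continuous (fderiv ℝ φ) := hφ.continuous_fderiv one_ne_zero
  have hω2 : ContDiff ℝ 1 ω2 := contDiff_periodicWindow_sq L
  have hΦ1 : ContDiff ℝ 1 Φ := contDiff_mul_comp_apply_two hφ hω2
  have hΦc : HasCompactSupport Φ :=
    hasCompactSupport_mul_comp_apply_two hφ0 (abs_le_of_periodicWindow_sq_ne_zero hL)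
  -- the derivative of the nonnegative cut-off vanishes where the cut-off vanishes (local minimum)
  have hφD0 : ∀ x, ρ ≤ cylRadius x → fderiv ℝ φ x = 0 := fun x hx => by
    have hmin : IsLocalMin φ x := Eventually.of_forall fun y => by rw [hφ0 x hx]; exact hφnn y
    exact hmin.fderiv_eq_zero
  have hDΦ : ∀ (x v : EuclideanSpace ℝ (Fin 3)),
      fderiv ℝ Φ x v = ω2 (x 2) * fderiv ℝ φ x v + φ x * deriv ω2 (x 2) * v 2 := fun x v =>
    fderiv_mul_comp_apply_two (hφ.differentiable one_ne_zero x) (hω2.differentiable one_ne_zero _) v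
  -- periodicity of the derived fields
  have hDwper : IsAxiallyPeriodic L (fderiv ℝ w) := isAxiallyPeriodic_fderiv hwper
  have hDφper : IsAxiallyPeriodic L (fderiv ℝ φ) := isAxiallyPeriodic_fderiv hφper
  -- the whole-space identity
  have id := linearised_energy_identity b hU hw hq hdivU hdivw hpde hΦ1 hΦc
  -- the six densities and the four window-derivative densities
  -- (0) `φ |Dw|²`
  have hFc : Continuous fun x => frobeniusNormSq (fderiv ℝ w x) :=
    continuous_frobeniusNormSq_fderiv hw1 one_ne_zero
  obtain ⟨c0, -, -, -⟩ := window_bookkeeping hL (Q := fun x => φ x * frobeniusNormSq (fderiv ℝ w x))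
    (hφc.mul hFc) (fun x => by simp only [hφper x, hDwper x]) (ρ := ρ)
    (fun x hx => by rw [hφ0 x hx, zero_mul])
  have e0 : ∫ x, Φ x * frobeniusNormSq (fderiv ℝ w x) =
      ∫ x in zSlab L 0, φ x * frobeniusNormSq (fderiv ℝ w x) := by
    rw [← c0]; refine integral_congr_ae (Eventually.of_forall fun x => ?_)
    simp only [hΦ]; ring
  -- (1) `∂ᵢΦ ⟪∂ᵢw, w⟫`
  have e1 : ∀ i, ∫ x, fderiv ℝ Φ x (b i) * ⟪fderiv ℝ w x (b i), w x⟫ =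
      ∫ x in zSlab L 0, fderiv ℝ φ x (b i) * ⟪fderiv ℝ w x (b i), w x⟫ := by
    intro i
    obtain ⟨cA, -, iA, -⟩ := window_bookkeeping hL
      (Q := fun x => fderiv ℝ φ x (b i) * ⟪fderiv ℝ w x (b i), w x⟫)
      ((hDφc.clm_apply continuous_const).mul ((hDwc.clm_apply continuous_const).inner hwc))
      (fun x => by simp only [hDφper x, hDwper x, hwper x]) (ρ := ρ)
      (fun x hx => by rw [hφD0 x hx]; simp)
    obtain ⟨-, cB, -, iB⟩ := window_bookkeeping hL
      (Q := fun x => φ x * (b i) 2 * ⟪fderiv ℝ w x (b i), w x⟫)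
      ((hφc.mul continuous_const).mul ((hDwc.clm_apply continuous_const).inner hwc))
      (fun x => by simp only [hφper x, hDwper x, hwper x]) (ρ := ρ)
      (fun x hx => by rw [hφ0 x hx]; simp)
    rw [← cA, ← add_zero (∫ x, fderiv ℝ φ x (b i) * _ * _), ← cB, ← integral_add iA iB]
    refine integral_congr_ae (Eventually.of_forall fun x => ?_)
    simp only [hDΦ]; ring
  -- (2) `DΦ·U ‖w‖²`
  have e2 : ∫ x, fderiv ℝ Φ x (U x) * ‖w x‖ ^ 2 =
      ∫ x in zSlab L 0, fderiv ℝ φ x (U x) * ‖w x‖ ^ 2 := by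
    obtain ⟨cA, -, iA, -⟩ := window_bookkeeping hL
      (Q := fun x => fderiv ℝ φ x (U x) * ‖w x‖ ^ 2)
      ((hDφc.clm_apply hUc).mul (hwc.norm.pow 2))
      (fun x => by simp only [hDφper x, hUper x, hwper x]) (ρ := ρ)
      (fun x hx => by rw [hφD0 x hx]; simp)
    obtain ⟨-, cB, -, iB⟩ := window_bookkeeping hL
      (Q := fun x => φ x * (U x) 2 * ‖w x‖ ^ 2)
      ((hφc.mul ((continuous_apply 2).comp ((PiLp.continuous_ofLp 2 _).comp hUc))).mul
        (hwc.norm.pow 2))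
      (fun x => by simp only [hφper x, hUper x, hwper x]) (ρ := ρ)
      (fun x hx => by rw [hφ0 x hx]; simp)
    rw [← cA, ← add_zero (∫ x, fderiv ℝ φ x (U x) * _ * _), ← cB, ← integral_add iA iB]
    refine integral_congr_ae (Eventually.of_forall fun x => ?_)
    simp only [hDΦ]; ring
  -- (3) `DΦ·w ⟪U, w⟫`
  have e3 : ∫ x, fderiv ℝ Φ x (w x) * ⟪U x, w x⟫ =
      ∫ x in zSlab L 0, fderiv ℝ φ x (w x) * ⟪U x, w x⟫ := by
    obtain ⟨cA, -, iA, -⟩ := window_bookkeeping hL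
      (Q := fun x => fderiv ℝ φ x (w x) * ⟪U x, w x⟫)
      ((hDφc.clm_apply hwc).mul (hUc.inner hwc))
      (fun x => by simp only [hDφper x, hUper x, hwper x]) (ρ := ρ)
      (fun x hx => by rw [hφD0 x hx]; simp)
    obtain ⟨-, cB, -, iB⟩ := window_bookkeeping hL
      (Q := fun x => φ x * (w x) 2 * ⟪U x, w x⟫)
      ((hφc.mul ((continuous_apply 2).comp ((PiLp.continuous_ofLp 2 _).comp hwc))).mul
        (hUc.inner hwc))
      (fun x => by simp only [hφper x, hUper x, hwper x]) (ρ := ρ)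
      (fun x hx => by rw [hφ0 x hx]; simp)
    rw [← cA, ← add_zero (∫ x, fderiv ℝ φ x (w x) * _ * _), ← cB, ← integral_add iA iB]
    refine integral_congr_ae (Eventually.of_forall fun x => ?_)
    simp only [hDΦ]; ring
  -- (4) `Φ ⟪U, Dw(w)⟫`
  have e4 : ∫ x, Φ x * ⟪U x, fderiv ℝ w x (w x)⟫ =
      ∫ x in zSlab L 0, φ x * ⟪U x, fderiv ℝ w x (w x)⟫ := by
    obtain ⟨cA, -, -, -⟩ := window_bookkeeping hL
      (Q := fun x => φ x * ⟪U x, fderiv ℝ w x (w x)⟫)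
      (hφc.mul (hUc.inner (hDwc.clm_apply hwc)))
      (fun x => by simp only [hφper x, hUper x, hDwper x, hwper x]) (ρ := ρ)
      (fun x hx => by rw [hφ0 x hx, zero_mul])
    rw [← cA]; refine integral_congr_ae (Eventually.of_forall fun x => ?_)
    simp only [hΦ]; ring
  -- (5) `q DΦ·w`
  have e5 : ∫ x, q x * fderiv ℝ Φ x (w x) = ∫ x in zSlab L 0, q x * fderiv ℝ φ x (w x) := by
    obtain ⟨cA, -, iA, -⟩ := window_bookkeeping hL
      (Q := fun x => q x * fderiv ℝ φ x (w x))
      (hqc.mul (hDφc.clm_apply hwc))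
      (fun x => by simp only [hDφper x, hqper x, hwper x]) (ρ := ρ)
      (fun x hx => by rw [hφD0 x hx]; simp)
    obtain ⟨-, cB, -, iB⟩ := window_bookkeeping hL
      (Q := fun x => q x * φ x * (w x) 2)
      ((hqc.mul hφc).mul ((continuous_apply 2).comp ((PiLp.continuous_ofLp 2 _).comp hwc)))
      (fun x => by simp only [hφper x, hqper x, hwper x]) (ρ := ρ)
      (fun x hx => by rw [hφ0 x hx]; simp)
    rw [← cA, ← add_zero (∫ x, q x * _ * _), ← cB, ← integral_add iA iB]
    refine integral_congr_ae (Eventually.of_forall fun x => ?_)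
    simp only [hDΦ]; ring
  rw [e0, e2, e3, e4, e5] at id
  simp_rw [e1] at id
  exact id

end Summit.NavierStokesRegularity.NavierStokesRegularity.Theorems.ScenarioCensus.PeriodicSlab

end
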